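import Summits.Ventures.Crystal3D.Theorems.StickyWulffConstantStackingLiminfLayerChainV4Defs
import Summits.Ventures.Crystal3D.Theorems.StickyWulffConstantStackingLiminfStackTensionContinuity
import Summits.Ventures.Crystal3D.Theorems.StickyWulffConstantStackingLiminfChimeraContent
import HarnessLib

/-!
# Stub (A) `stub_modulatedWulff` of line `LayerChain` v4 — the HEIGHT-MODULATED anisotropic
# Wulff inequality for smooth functions (crux `StackingLiminf`, stmt-Ventures-19145)

Route `StickyWulffConstant` of the venture `Summits/Ventures/Crystal3D` (cell `crystal3d-full`).
Statement (`ModulatedWulff` of `StickyWulffConstantStackingLiminfLayerChainV4Defs`, p505287, the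
REGISTERED signature of the stub): for every `C²` compactly supported `w : ℝ³ → [0, ∞)` and every
continuous profile `g : ℝ → [0,1]`,

`3 · (64√2)^{1/3} · ∫_0^∞ |{w > t}|^{2/3} dt ≤ ∫ φ_{g(y₂)}(−∇w(y)) dy`

(`plateau w` on the left, `modTV w g` on the right; `φ_f = stackTension f` the homogenised stacking
tension, `64√2 = |W_0|` the volume of the fcc Wulff body).  At `g ≡ const` this is the sharp
anisotropic Wulff/Sobolev inequality for the gauge of `W_g` (via `|W_g| ≥ |W_0|`); the point is that
the profile may vary with HEIGHT at no cost.

Proof (no sup-convolution, no transport, no coarea, no dominated convergence).  Fix `ε > 0`.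
`G(y) = φ_{g(y₂)}(−∇w(y))` is continuous (`continuous_stackTension`, p505616) with support in
`supp w ⊆ B̄(0,R₀)`; the two-point function `(a, ξ) ↦ φ_{g(a₂)}(−∇w(ξ))` is uniformly continuous on
the compact `K' × K'`, `K' = B̄(0, R₀ + 9)` (`W_f ⊆ B̄(0,9)`, `norm_le_nine_of_mem_stackWulff`); let
`δ` be an `ε`-modulus and `r = min 1 (δ/18)`.  MEAN VALUE STEP
(`sub_le_mul_stackTension_of_mem_stackWulff`): for `u ∈ W_{g(a₂)}`, Lagrange on the segment gives
`w(a) − w(a + r u) = r (−∇w(z))·u ≤ r φ_{g(a₂)}(−∇w(z))` with `z` within `9r < δ` of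
`y = a + r u`, hence `< r (G(y) + ε)`.  So for every level `t > 0` the chimera sum
`{w > t} +_g rW` lies in `{F > t}`, `F = w + r (G + ε·1_{K'})`.  The in-tree CHIMERA BRUNN–MINKOWSKI
content inequality `Chimera.chimera_stackWulff_content` (p496790; every profile, every `r`) gives
`|{w>t}| + 3 r |W_0|^{1/3} |{w>t}|^{2/3} ≤ |{F>t}|`; integrating over `t > 0` and applying the
layer-cake formula (`lintegral_eq_lintegral_meas_lt`) to `w` and to `F`:
`∫w + 3r|W_0|^{1/3}·P ≤ ∫F = ∫w + r (∫G + ε |K'|)`.  Cancel `∫w < ∞` and `r > 0`, let `ε → 0`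
(`ENNReal.le_of_forall_pos_le_add`), and convert to real numbers.
WHAT THIS IS NOT: stubs (B) `MollifiedUpper`, (C) `PlateauBound`, (D) `MollifierRegularity` of the
line are untouched; nothing discrete; rung F-C1 not moved.
-/

noncomputable section

namespace Summit.Ventures.Crystal3D.Theorems

open MeasureTheory Set Filter Topology Metric
open Summit.Ventures.Crystal3D.Cruxes.StackingLiminf.LayerChainV4 (negGrad modTV plateau ModulatedWulff)
open Summit.Ventures.Crystal3D.LayerChain (dot3 stackTension stackWulff)
open Summit.Ventures.Crystal3D.Theorems.Chimera (chimera_stackWulff_content)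
open Summit.Ventures.Crystal3D.Theorems.ModulatedWulff
open scoped ENNReal

/-! ### Step 1 — the first-order (mean value) step -/

/-- `∇w(z)·u = Σ_j u_j ∂_j w(z)`, i.e. `−∇w(z)·u = u · negGrad w z`. -/
theorem fderiv_apply_eq_neg_dot3_negGrad (w : (Fin 3 → ℝ) → ℝ) (z u : Fin 3 → ℝ) :
    fderiv ℝ w z u = -dot3 u (negGrad w z) := by
  have hu : fderiv ℝ w z u = ∑ j : Fin 3, u j * fderiv ℝ w z (Pi.single j 1) := by
    conv_lhs => rw [pi_eq_sum_univ' u]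
    rw [map_sum]
    simp only [map_smul, smul_eq_mul]
  rw [hu]
  simp only [negGrad, dot3, Fin.sum_univ_three]
  ring

/-- **Mean value step.**  If `u ∈ W_{g(a₂)}` and `r ≥ 0` then, for some `z` on the segment from
`a + r u` back to `a`, `w(a) − w(a + r u) ≤ r · φ_{g(a₂)}(−∇w(z))` (Lagrange's theorem on the segment
and `u·p ≤ φ_f(p)` for `u ∈ W_f`). -/
theorem sub_le_mul_stackTension_of_mem_stackWulff {w : (Fin 3 → ℝ) → ℝ} (hw : Differentiable ℝ w)
    (g : ℝ → ℝ) (a u : Fin 3 → ℝ) (hu : u ∈ stackWulff (g (a 2))) {r : ℝ} (hr : 0 ≤ r) :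
    ∃ z ∈ segment ℝ (a + r • u) a,
      w a - w (a + r • u) ≤ r * stackTension (g (a 2)) (negGrad w z) := by
  obtain ⟨z, hz, heq⟩ := domain_mvt (f := w) (s := Set.univ) (x := a + r • u) (y := a)
    (f' := fun x => fderiv ℝ w x) (fun x _ => (hw x).hasFDerivAt.hasFDerivWithinAt) convex_univ
    (mem_univ _) (mem_univ _)
  refine ⟨z, hz, ?_⟩
  rw [heq, show a - (a + r • u) = -(r • u) by abel, map_neg, map_smul, smul_eq_mul,
    fderiv_apply_eq_neg_dot3_negGrad]
  have h := dot3_le_stackTension hu (negGrad w z)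
  nlinarith

/-! ### Step 2 — the stub -/

/-- **Stub (A) `stub_modulatedWulff` of line `LayerChain` v4 (crux `StackingLiminf`,
stmt-Ventures-19145): the HEIGHT-MODULATED anisotropic Wulff inequality for smooth functions,**
`3 |W_0|^{1/3} ∫_0^∞ |{w > t}|^{2/3} dt ≤ ∫ φ_{g(y₂)}(−∇w(y)) dy` for every C² compactly supported
`w ≥ 0` and continuous profile `g : ℝ → [0,1]` (`|W_0| = 64√2`).

Proof.  Fix `ε > 0`.  `G(y) = φ_{g(y₂)}(−∇w(y))` is continuous with compact support
(`continuous_stackTension`), hence uniformly continuous on the compact `K' = B̄(0, R₀ + 9)`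
(`supp w ⊆ B̄(0,R₀)`, `W_f ⊆ B̄(0,9)`) as a function of (profile point, gradient point); let `δ`
be an `ε`-modulus and `r = min 1 (δ/18)`.  For every level `t > 0`, every `a` with `w(a) > t` and
every `u ∈ W_{g(a₂)}`, Lagrange gives `w(a) − w(a + r u) ≤ r φ_{g(a₂)}(−∇w(z))` for a `z` within
`9r < δ` of `y = a + r u`, so `t < w(a) ≤ w(y) + r (G(y) + ε) =: F(y)`: the chimera sum
`{w > t} +_g rW` lies in `{F > t}`.  The in-tree chimera Brunn–Minkowski content inequality
(`Chimera.chimera_stackWulff_content`) gives `|{w>t}| + 3r|W_0|^{1/3}|{w>t}|^{2/3} ≤ |{F>t}|` for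
every `t > 0`; integrating in `t` and using the layer-cake formula on both sides,
`∫w + 3r|W_0|^{1/3}·plateau(w) ≤ ∫F = ∫w + r(∫G + ε|K'|)`.  Cancel `∫w` and `r`, then let `ε → 0`.
No sup-convolution, no transport, no coarea, no dominated convergence. -/
theorem stub_modulatedWulff : ModulatedWulff := by
  intro w g hw2 hwc hw0 hg hg01
  -- regularity of `w`
  have hw1 : ContDiff ℝ 1 w := hw2.of_le one_le_two
  have hwd : Differentiable ℝ w := hw1.differentiable one_ne_zero
  have hwc' : Continuous w := hw2.continuous
  have hfd : Continuous (fderiv ℝ w) := hw1.continuous_fderiv one_ne_zero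
  have hng : Continuous (negGrad w) :=
    continuous_pi fun j => (hfd.clm_apply continuous_const).neg
  have hKc : IsCompact (tsupport w) := hwc.isCompact
  -- the integrand `G`
  set G : (Fin 3 → ℝ) → ℝ := fun y => stackTension (g (y 2)) (negGrad w y) with hG
  have hGc : Continuous G := by
    have h1 : Continuous fun y : Fin 3 → ℝ => g (y 2) := hg.comp (continuous_apply 2)
    exact continuous_stackTension_comp h1 hng
  have hG0 : ∀ y, 0 ≤ G y := fun y => stackTension_nonneg _ _
  have hGsupp : ∀ y, y ∉ tsupport w → G y = 0 := by
    intro y hy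
    have hfy : fderiv ℝ w y = 0 := by
      by_contra h
      exact hy (support_fderiv_subset ℝ (Function.mem_support.2 h))
    have hng0 : negGrad w y = 0 := by
      ext j
      simp [negGrad, hfy]
    simp only [hG, hng0, stackTension_zero_right]
  have hGcs : HasCompactSupport G := HasCompactSupport.intro hKc hGsupp
  have hGint : Integrable G := hGc.integrable_of_hasCompactSupport hGcs
  set IG : ℝ≥0∞ := ∫⁻ y, ENNReal.ofReal (G y) with hIG
  have hIG_lt : IG < ⊤ := hGint.lintegral_lt_top
  have hmodTV : modTV w g = IG.toReal := by
    unfold modTV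
    exact integral_eq_lintegral_of_nonneg_ae (ae_of_all _ hG0) hGc.aestronglyMeasurable
  -- the support ball and the working compact `K'`
  obtain ⟨R₀, hR₀, hR₀K⟩ := hKc.isBounded.subset_closedBall_lt 0 (0 : Fin 3 → ℝ)
  set K' : Set (Fin 3 → ℝ) := closedBall (0 : Fin 3 → ℝ) (R₀ + 9) with hK'
  have hK'c : IsCompact K' := isCompact_closedBall _ _
  have hK'm : MeasurableSet K' := measurableSet_closedBall
  have hK'vol : volume K' < ⊤ := hK'c.measure_lt_top
  have hKK' : tsupport w ⊆ K' := fun a ha => by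
    have := hR₀K ha
    rw [mem_closedBall_zero_iff] at this ⊢
    linarith
  -- the two-point integrand and its uniform continuity on `K' × K'`
  set G2 : (Fin 3 → ℝ) × (Fin 3 → ℝ) → ℝ :=
    fun q => stackTension (g (q.1 2)) (negGrad w q.2) with hG2
  have hG2c : Continuous G2 := by
    have h1 : Continuous fun q : (Fin 3 → ℝ) × (Fin 3 → ℝ) => g (q.1 2) :=
      hg.comp ((continuous_apply 2).comp continuous_fst)
    have h2 : Continuous fun q : (Fin 3 → ℝ) × (Fin 3 → ℝ) => negGrad w q.2 :=
      hng.comp continuous_snd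
    exact continuous_stackTension_comp h1 h2
  have hUC : UniformContinuousOn G2 (K' ×ˢ K') :=
    (hK'c.prod hK'c).uniformContinuousOn_of_continuous hG2c.continuousOn
  -- the plateau side in `ℝ≥0∞`
  set P : ℝ≥0∞ := ∫⁻ t in Ioi (0 : ℝ), volume {y : Fin 3 → ℝ | t < w y} ^ ((2 : ℝ) / 3) with hP
  have hmeas1 : Measurable fun t : ℝ => volume {y : Fin 3 → ℝ | t < w y} :=
    Antitone.measurable fun s t hst => measure_mono fun y (hy : t < w y) => lt_of_le_of_lt hst hy
  have hmeas2 : Measurable fun t : ℝ => volume {y : Fin 3 → ℝ | t < w y} ^ ((2 : ℝ) / 3) :=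
    hmeas1.pow_const _
  have hlev_fin : ∀ t : ℝ, 0 < t → volume {y : Fin 3 → ℝ | t < w y} ≠ ⊤ := fun t ht =>
    (lt_of_le_of_lt (measure_mono fun y (hy : t < w y) =>
      subset_tsupport _ (Function.mem_support.2 (ht.trans hy).ne')) hKc.measure_lt_top).ne
  -- layer cake for `w`
  have hLw : ∫⁻ y, ENNReal.ofReal (w y) = ∫⁻ t in Ioi 0, volume {y : Fin 3 → ℝ | t < w y} :=
    lintegral_eq_lintegral_meas_lt volume (ae_of_all _ hw0) hwc'.measurable.aemeasurable
  have hLw_lt : ∫⁻ y, ENNReal.ofReal (w y) < ⊤ :=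
    (hwc'.integrable_of_hasCompactSupport hwc).lintegral_lt_top
  -- MAIN ESTIMATE: for every ε > 0
  have hmain : ∀ ε : ℝ, 0 < ε →
      3 * volume (stackWulff 0) ^ ((3 : ℕ)⁻¹ : ℝ) * P ≤ IG + ENNReal.ofReal ε * volume K' := by
    intro ε hε
    obtain ⟨δ, hδ, hδUC⟩ := Metric.uniformContinuousOn_iff.1 hUC ε hε
    set r : ℝ := min 1 (δ / 18) with hr
    have hr0 : 0 < r := lt_min one_pos (by positivity)
    have hr1 : r ≤ 1 := min_le_left _ _
    have hr9 : r * 9 < δ := by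
      have := min_le_right 1 (δ / 18)
      linarith
    -- the comparison function `F = w + r (G + ε 1_{K'})`
    set F : (Fin 3 → ℝ) → ℝ :=
      fun y => w y + r * (G y + ε * K'.indicator (fun _ => (1 : ℝ)) y) with hF
    have hind0 : ∀ y, 0 ≤ K'.indicator (fun _ => (1 : ℝ)) y := fun y =>
      Set.indicator_nonneg (fun _ _ => zero_le_one) y
    have hFm : Measurable F :=
      hwc'.measurable.add
        ((hGc.measurable.add ((measurable_const.indicator hK'm).const_mul ε)).const_mul r)
    have hF0 : ∀ y, 0 ≤ F y := fun y => by
      have := hw0 y; have := hG0 y; have := hind0 y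
      simp only [hF]; positivity
    -- the level-set inclusion `{w > t} +_g rW ⊆ {F > t}`
    have hincl : ∀ t : ℝ, 0 < t → ∀ a ∈ {y : Fin 3 → ℝ | t < w y},
        ∀ u ∈ stackWulff (g (a 2)), a + r • u ∈ {y : Fin 3 → ℝ | t < F y} := by
      intro t ht a ha u hu
      simp only [mem_setOf_eq] at ha ⊢
      have haK : a ∈ K' := hKK' (subset_tsupport _ (Function.mem_support.2 (ht.trans ha).ne'))
      have hu9 : ‖u‖ ≤ 9 := norm_le_nine_of_mem_stackWulff (hg01 _).1 (hg01 _).2 hu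
      have hru : ‖r • u‖ ≤ r * 9 := by
        rw [norm_smul, Real.norm_eq_abs, abs_of_pos hr0]
        exact mul_le_mul_of_nonneg_left hu9 hr0.le
      have hyK : a + r • u ∈ K' := by
        rw [hK', mem_closedBall_zero_iff] at haK ⊢
        have := norm_add_le a (r • u)
        have hR : ‖a‖ ≤ R₀ := by
          have := hR₀K (subset_tsupport _ (Function.mem_support.2 (ht.trans ha).ne'))
          rwa [mem_closedBall_zero_iff] at this
        nlinarith
      obtain ⟨z, hz, hle⟩ := sub_le_mul_stackTension_of_mem_stackWulff hwd g a u hu hr0.le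
      have hd1 : dist a (a + r • u) ≤ r * 9 := by
        rw [dist_eq_norm, sub_add_cancel_left, norm_neg]
        exact hru
      have hzB : z ∈ closedBall (a + r • u) (r * 9) :=
        (convex_closedBall _ _).segment_subset (mem_closedBall_self (by positivity))
          (mem_closedBall.2 hd1) hz
      have hzK : z ∈ K' := (convex_closedBall _ _).segment_subset hyK haK hz
      have hd : dist ((a, z) : (Fin 3 → ℝ) × (Fin 3 → ℝ)) (a + r • u, a + r • u) < δ := by
        rw [Prod.dist_eq]
        exact max_lt (lt_of_le_of_lt hd1 hr9) (lt_of_le_of_lt (mem_closedBall.1 hzB) hr9)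
      have hG2ε := hδUC (a, z) (Set.mk_mem_prod haK hzK) (a + r • u, a + r • u)
        (Set.mk_mem_prod hyK hyK) hd
      rw [Real.dist_eq] at hG2ε
      have hlt : stackTension (g (a 2)) (negGrad w z) < G (a + r • u) + ε := by
        have := (abs_sub_lt_iff.1 hG2ε).1
        simp only [hG2, hG] at this ⊢
        linarith
      have hlt' := mul_lt_mul_of_pos_left hlt hr0
      simp only [hF, Set.indicator_of_mem hyK, mul_one]
      linarith
    -- chimera Brunn–Minkowski, level by level
    have hchim : ∀ t : ℝ, 0 < t →
        volume {y : Fin 3 → ℝ | t < w y} +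
          3 * (ENNReal.ofReal r * volume (stackWulff 0) ^ ((3 : ℕ)⁻¹ : ℝ)) *
            volume {y : Fin 3 → ℝ | t < w y} ^ ((2 : ℝ) / 3) ≤ volume {y : Fin 3 → ℝ | t < F y} :=
      fun t ht => chimera_stackWulff_content hg01 (measurableSet_lt measurable_const hwc'.measurable)
        (measurableSet_lt measurable_const hFm) hr0 (hincl t ht) (hlev_fin t ht)
    -- integrate in `t`
    have hint : (∫⁻ t in Ioi (0 : ℝ), volume {y : Fin 3 → ℝ | t < w y}) +
        3 * (ENNReal.ofReal r * volume (stackWulff 0) ^ ((3 : ℕ)⁻¹ : ℝ)) * P ≤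
        ∫⁻ t in Ioi (0 : ℝ), volume {y : Fin 3 → ℝ | t < F y} := by
      rw [hP, ← lintegral_const_mul _ hmeas2, ← lintegral_add_left hmeas1]
      exact setLIntegral_mono' measurableSet_Ioi fun t ht => hchim t ht
    -- layer cake for `F` and the split of `∫ F`
    have hLF : ∫⁻ y, ENNReal.ofReal (F y) = ∫⁻ t in Ioi 0, volume {y : Fin 3 → ℝ | t < F y} :=
      lintegral_eq_lintegral_meas_lt volume (ae_of_all _ hF0) hFm.aemeasurable
    have hFsplit : ∫⁻ y, ENNReal.ofReal (F y) =
        (∫⁻ y, ENNReal.ofReal (w y)) + ENNReal.ofReal r * (IG + ENNReal.ofReal ε * volume K') := by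
      have h1 : ∀ y, ENNReal.ofReal (F y) = ENNReal.ofReal (w y) + ENNReal.ofReal r *
          (ENNReal.ofReal (G y) + ENNReal.ofReal ε * K'.indicator (fun _ => (1 : ℝ≥0∞)) y) := by
        intro y
        have hi := hind0 y
        simp only [hF]
        rw [ENNReal.ofReal_add (hw0 y) (by have := hG0 y; positivity), ENNReal.ofReal_mul hr0.le,
          ENNReal.ofReal_add (hG0 y) (by positivity), ENNReal.ofReal_mul hε.le]
        by_cases hy : y ∈ K'
        · simp [Set.indicator_of_mem hy]
        · simp [Set.indicator_of_notMem hy]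
      have hm1 : Measurable fun y => ENNReal.ofReal (w y) := hwc'.measurable.ennreal_ofReal
      have hm2 : Measurable fun y => ENNReal.ofReal (G y) := hGc.measurable.ennreal_ofReal
      have hm4 : Measurable fun y => ENNReal.ofReal ε * K'.indicator (fun _ => (1 : ℝ≥0∞)) y :=
        (measurable_const.indicator hK'm).const_mul _
      have hm3 : Measurable fun y =>
          ENNReal.ofReal (G y) + ENNReal.ofReal ε * K'.indicator (fun _ => (1 : ℝ≥0∞)) y :=
        hm2.add hm4
      simp_rw [h1]
      rw [lintegral_add_left hm1, lintegral_const_mul _ hm3, lintegral_add_left hm2,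
        lintegral_const_mul _ (measurable_const.indicator hK'm), lintegral_indicator_const hK'm,
        one_mul]
    -- combine and cancel
    have hcomb : (∫⁻ y, ENNReal.ofReal (w y)) +
        3 * (ENNReal.ofReal r * volume (stackWulff 0) ^ ((3 : ℕ)⁻¹ : ℝ)) * P ≤
        (∫⁻ y, ENNReal.ofReal (w y)) + ENNReal.ofReal r * (IG + ENNReal.ofReal ε * volume K') := by
      calc (∫⁻ y, ENNReal.ofReal (w y)) +
            3 * (ENNReal.ofReal r * volume (stackWulff 0) ^ ((3 : ℕ)⁻¹ : ℝ)) * P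
        _ = (∫⁻ t in Ioi (0 : ℝ), volume {y : Fin 3 → ℝ | t < w y}) +
            3 * (ENNReal.ofReal r * volume (stackWulff 0) ^ ((3 : ℕ)⁻¹ : ℝ)) * P := by rw [hLw]
        _ ≤ ∫⁻ t in Ioi (0 : ℝ), volume {y : Fin 3 → ℝ | t < F y} := hint
        _ = ∫⁻ y, ENNReal.ofReal (F y) := hLF.symm
        _ = _ := hFsplit
    have hcancel := (ENNReal.add_le_add_iff_left hLw_lt.ne).1 hcomb
    have hr' : ENNReal.ofReal r ≠ 0 := (ENNReal.ofReal_pos.2 hr0).ne'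
    have hfin : ENNReal.ofReal r * (3 * volume (stackWulff 0) ^ ((3 : ℕ)⁻¹ : ℝ) * P) ≤
        ENNReal.ofReal r * (IG + ENNReal.ofReal ε * volume K') := by
      calc ENNReal.ofReal r * (3 * volume (stackWulff 0) ^ ((3 : ℕ)⁻¹ : ℝ) * P)
        _ = 3 * (ENNReal.ofReal r * volume (stackWulff 0) ^ ((3 : ℕ)⁻¹ : ℝ)) * P := by ring
        _ ≤ _ := hcancel
    exact (ENNReal.mul_le_mul_iff_right hr' ENNReal.ofReal_ne_top).1 hfin
  -- ε → 0
  have hle : 3 * volume (stackWulff 0) ^ ((3 : ℕ)⁻¹ : ℝ) * P ≤ IG := by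
    refine ENNReal.le_of_forall_pos_le_add fun ε' hε' _ => ?_
    have hV0 : 0 ≤ (volume K').toReal := ENNReal.toReal_nonneg
    have h := hmain ((ε' : ℝ) / ((volume K').toReal + 1)) (by positivity)
    have hKε : ENNReal.ofReal ((ε' : ℝ) / ((volume K').toReal + 1)) * volume K' ≤ (ε' : ℝ≥0∞) := by
      rw [← ENNReal.ofReal_toReal hK'vol.ne, ← ENNReal.ofReal_mul (by positivity),
        ENNReal.ofReal_toReal hK'vol.ne, ← ENNReal.ofReal_coe_nnreal]
      apply ENNReal.ofReal_le_ofReal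
      rw [div_mul_eq_mul_div, div_le_iff₀ (by positivity)]
      nlinarith [NNReal.coe_nonneg ε']
    exact h.trans (by gcongr)
  -- back to real numbers
  have hW0 : volume (stackWulff 0) ^ ((3 : ℕ)⁻¹ : ℝ) =
      ENNReal.ofReal ((64 * Real.sqrt 2) ^ ((1 : ℝ) / 3)) := by
    rw [volume_stackWulff_zero, ENNReal.ofReal_rpow_of_nonneg (by positivity) (by positivity)]
    norm_num
  have hplat : plateau w = P.toReal := by
    unfold plateau
    rw [integral_eq_lintegral_of_nonneg_ae (ae_of_all _ fun t => by positivity)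
      (hmeas1.ennreal_toReal.pow_const _).aestronglyMeasurable]
    congr 1
    refine setLIntegral_congr_fun measurableSet_Ioi fun t ht => ?_
    rw [← ENNReal.ofReal_rpow_of_nonneg ENNReal.toReal_nonneg (by norm_num),
      ENNReal.ofReal_toReal (hlev_fin t ht)]
  rw [hplat, hmodTV]
  have h := ENNReal.toReal_mono hIG_lt.ne hle
  rw [ENNReal.toReal_mul, ENNReal.toReal_mul, hW0, ENNReal.toReal_ofReal (by positivity)] at h
  simpa using h

end Summit.Ventures.Crystal3D.Theorems

end
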